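import Literature.NumberTheory.ModularForms.GammaTranslatesRational
import Literature.NumberTheory.ModularForms.EisensteinLatticeCosetGalois
import HarnessLib

/-!
# Galois conjugation of `q_N`-expansions on `Γ(N)`: the algebra (set-up for the Galois-action
# half of the `q`-expansion principle for `SL₂(ℤ)`-translates)

Topic `Literature/NumberTheory/ModularForms`; namespace `Literature.NumberTheory.ModularForms`.
Companion of `GammaTranslatesSetup` (there: `K`-RATIONALITY of `q_N`-expansions is preserved by the
algebra of `formSpace Γ(N) k`).  Here, for a ring endomorphism `σ` of `ℂ`, the relation
"`f'` is the `σ`-CONJUGATE of `f`", i.e. `qExpansion N f' = (qExpansion N f).map σ` (Shimura 1971,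
§6.2: the action of `Aut(ℂ)` on Fourier coefficients; no new definition — the relation is written
out), is shown to be preserved by the same algebra:

* `conj_add/smul/mul/pow/sum/sub/finset_prod/vdmDet` — sums, scalar multiples (`σ c • f'`),
  products, powers, finite sums and products, the Vandermonde determinant of `GammaTranslatesCramer`;
* `eq_of_conj_of_conj`, `eq_of_conj_eq_conj`, `ne_zero_of_conj` — a form has at most one conjugate,
  conjugation is injective, and preserves `≢ 0` (the `q`-expansion principle at `∞` on `Γ(N)`);
* `conj_of_mul_left` — **division**: `d q = r`, `d' q' = r'`, `d'`/`r'` conjugates of `d ≢ 0`/`r`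
  ⟹ `q'` is the conjugate of `q`;
* `exists_levelOne_conj` — every level-one form `M` has a level-one `σ`-conjugate `M^{(σ)}` of the
  same weight (`M` is a `ℂ`-combination of forms with `σ`-fixed, indeed integral, `q`-expansions —
  monomials in `E₄, E₆` — and `σ` is applied to the coefficients; Shimura (6.1.3));
* `conj_eisE`, `conj_thetaComb` — **the Eisenstein input**: for `σ(ζ_N) = ζ_N^d`, `dd' ≡ 1 (N)`,
  the conjugate of `E^u = c₄G_4^u` is `E^{u·diag(1,d)}`, and the conjugate of the combination
  `θ_λ^g = ∑_u λ_u E^{ug}` with `σ`-fixed `λ_u` is `θ_{λ'}^{D'gD}`, `λ'_v = λ_{vD'}`,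
  `D = diag(1,d)`, `D' = diag(1,d')` (`EisensteinLatticeCosetGalois`).

Everything is proved; no definition, no named fact.

## References

* [ShimuraIATAF1971] G. Shimura, *Introduction to the arithmetic theory of automorphic
  functions*, Princeton (1971), §6.1 (6.1.3), §6.2 (Thm. 6.6, Prop. 6.9, the action of
  `GL₂(ℤ/Nℤ)` on `𝔉_N`).
* [DiamondShurman2005] F. Diamond, J. Shurman, *A First Course in Modular Forms*, GTM 228
  (2005), §4.2, §7.7.
-/

noncomputable section

namespace Literature.NumberTheory.ModularForms

open scoped MatrixGroups Real CongruenceSubgroup Matrix ModularForm Topology Manifold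
open UpperHalfPlane hiding I
open Complex Filter Function PowerSeries ModularForm
open Literature.NumberTheory.EllipticCurves.ModularForms (formSpace levelOneSpace mem_formSpace
  mem_formSpace_iff coe_mem_formSpace mul_mem_formSpace pow_mem_formSpace formSpace_mono
  mdifferentiable_of_mem_formSpace slash_eq_of_mem_formSpace isBoundedAtImInfty_slash_of_mem_formSpace
  formSpace_eq_bot_of_neg levelOneSpace_le_sup E4_mem E6_mem eq_zero_of_mul_eq_zero_of_mdifferentiable
  exists_int_map_eq_qExpansion_E₄ exists_int_map_eq_qExpansion_E₆)

/-! ### Conjugation and the algebra of `formSpace Γ(N) k` -/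

section Algebra

variable (σ : ℂ →+* ℂ) {N : ℕ} [NeZero N]

omit [NeZero N] in
/-- The zero function is its own conjugate. [cite: ShimuraIATAF1971, §6.2 (Prop. 6.9: the action of `Aut(ℂ)` on Fourier coefficients)] -/
theorem conj_zero : qExpansion (N : ℝ) (0 : ℍ → ℂ) = (qExpansion (N : ℝ) (0 : ℍ → ℂ)).map σ := by
  rw [qExpansion_zero, map_zero]

omit [NeZero N] in
/-- The constant function `1` is its own conjugate. [cite: ShimuraIATAF1971, §6.2 (Prop. 6.9: the action of `Aut(ℂ)` on Fourier coefficients)] -/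
theorem conj_one : qExpansion (N : ℝ) (1 : ℍ → ℂ) = (qExpansion (N : ℝ) (1 : ℍ → ℂ)).map σ := by
  rw [qExpansion_one, map_one]

/-- Sums. [cite: ShimuraIATAF1971, §6.2 (Prop. 6.9: the action of `Aut(ℂ)` on Fourier coefficients)] -/
theorem conj_add {k : ℤ} {f g f' g' : ℍ → ℂ} (hf : f ∈ formSpace (CongruenceSubgroup.Gamma N) k)
    (hg : g ∈ formSpace (CongruenceSubgroup.Gamma N) k) (hf' : f' ∈ formSpace (CongruenceSubgroup.Gamma N) k)
    (hg' : g' ∈ formSpace (CongruenceSubgroup.Gamma N) k)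
    (h₁ : qExpansion (N : ℝ) f' = (qExpansion (N : ℝ) f).map σ)
    (h₂ : qExpansion (N : ℝ) g' = (qExpansion (N : ℝ) g).map σ) :
    qExpansion (N : ℝ) (f' + g') = (qExpansion (N : ℝ) (f + g)).map σ := by
  rw [qExpansion_add (analyticAt_cuspFunction_of_mem hf') (analyticAt_cuspFunction_of_mem hg'),
    qExpansion_add (analyticAt_cuspFunction_of_mem hf) (analyticAt_cuspFunction_of_mem hg),
    map_add, h₁, h₂]

/-- Differences. [cite: ShimuraIATAF1971, §6.2 (Prop. 6.9: the action of `Aut(ℂ)` on Fourier coefficients)] -/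
theorem conj_sub {k : ℤ} {f g f' g' : ℍ → ℂ} (hf : f ∈ formSpace (CongruenceSubgroup.Gamma N) k)
    (hg : g ∈ formSpace (CongruenceSubgroup.Gamma N) k) (hf' : f' ∈ formSpace (CongruenceSubgroup.Gamma N) k)
    (hg' : g' ∈ formSpace (CongruenceSubgroup.Gamma N) k)
    (h₁ : qExpansion (N : ℝ) f' = (qExpansion (N : ℝ) f).map σ)
    (h₂ : qExpansion (N : ℝ) g' = (qExpansion (N : ℝ) g).map σ) :
    qExpansion (N : ℝ) (f' - g') = (qExpansion (N : ℝ) (f - g)).map σ := by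
  rw [qExpansion_sub (analyticAt_cuspFunction_of_mem hf') (analyticAt_cuspFunction_of_mem hg'),
    qExpansion_sub (analyticAt_cuspFunction_of_mem hf) (analyticAt_cuspFunction_of_mem hg),
    map_sub, h₁, h₂]

/-- Scalar multiples: the conjugate of `c • f` is `σ(c) • f'`. [cite: ShimuraIATAF1971, §6.2 (Prop. 6.9: the action of `Aut(ℂ)` on Fourier coefficients)] -/
theorem conj_smul {k : ℤ} {f f' : ℍ → ℂ} (hf : f ∈ formSpace (CongruenceSubgroup.Gamma N) k)
    (hf' : f' ∈ formSpace (CongruenceSubgroup.Gamma N) k)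
    (h : qExpansion (N : ℝ) f' = (qExpansion (N : ℝ) f).map σ) (c : ℂ) :
    qExpansion (N : ℝ) (σ c • f') = (qExpansion (N : ℝ) (c • f)).map σ := by
  rw [qExpansion_smul (analyticAt_cuspFunction_of_mem hf'), qExpansion_smul (analyticAt_cuspFunction_of_mem hf), h]
  ext n
  simp [PowerSeries.coeff_map]

/-- Products (of forms of possibly different weights). [cite: ShimuraIATAF1971, §6.2 (Prop. 6.9: the action of `Aut(ℂ)` on Fourier coefficients)] -/
theorem conj_mul {k₁ k₂ : ℤ} {f g f' g' : ℍ → ℂ} (hf : f ∈ formSpace (CongruenceSubgroup.Gamma N) k₁)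
    (hg : g ∈ formSpace (CongruenceSubgroup.Gamma N) k₂) (hf' : f' ∈ formSpace (CongruenceSubgroup.Gamma N) k₁)
    (hg' : g' ∈ formSpace (CongruenceSubgroup.Gamma N) k₂)
    (h₁ : qExpansion (N : ℝ) f' = (qExpansion (N : ℝ) f).map σ)
    (h₂ : qExpansion (N : ℝ) g' = (qExpansion (N : ℝ) g).map σ) :
    qExpansion (N : ℝ) (f' * g') = (qExpansion (N : ℝ) (f * g)).map σ := by
  rw [qExpansion_mul (analyticAt_cuspFunction_of_mem hf') (analyticAt_cuspFunction_of_mem hg'),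
    qExpansion_mul (analyticAt_cuspFunction_of_mem hf) (analyticAt_cuspFunction_of_mem hg),
    map_mul, h₁, h₂]

/-- Powers. [cite: ShimuraIATAF1971, §6.2 (Prop. 6.9: the action of `Aut(ℂ)` on Fourier coefficients)] -/
theorem conj_pow {k : ℤ} {f f' : ℍ → ℂ} (hf : f ∈ formSpace (CongruenceSubgroup.Gamma N) k)
    (hf' : f' ∈ formSpace (CongruenceSubgroup.Gamma N) k)
    (h : qExpansion (N : ℝ) f' = (qExpansion (N : ℝ) f).map σ) (m : ℕ) :
    qExpansion (N : ℝ) (f' ^ m) = (qExpansion (N : ℝ) (f ^ m)).map σ := by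
  induction m with
  | zero => rw [pow_zero, pow_zero]; exact conj_one σ
  | succ m ih =>
    rw [pow_succ, pow_succ]
    exact conj_mul σ (pow_mem_formSpace hf m) hf (pow_mem_formSpace hf' m) hf' ih h

/-- Finite sums of forms of a common weight. [cite: ShimuraIATAF1971, §6.2 (Prop. 6.9: the action of `Aut(ℂ)` on Fourier coefficients)] -/
theorem conj_sum {ι : Type*} {k : ℤ} (s : Finset ι) {f f' : ι → ℍ → ℂ}
    (hf : ∀ i ∈ s, f i ∈ formSpace (CongruenceSubgroup.Gamma N) k)
    (hf' : ∀ i ∈ s, f' i ∈ formSpace (CongruenceSubgroup.Gamma N) k)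
    (h : ∀ i ∈ s, qExpansion (N : ℝ) (f' i) = (qExpansion (N : ℝ) (f i)).map σ) :
    qExpansion (N : ℝ) (∑ i ∈ s, f' i) = (qExpansion (N : ℝ) (∑ i ∈ s, f i)).map σ := by
  classical
  induction s using Finset.induction_on with
  | empty => rw [Finset.sum_empty, Finset.sum_empty]; exact conj_zero σ
  | insert a s ha ih =>
    rw [Finset.sum_insert ha, Finset.sum_insert ha]
    have hs : ∀ i ∈ s, f i ∈ formSpace (CongruenceSubgroup.Gamma N) k :=
      fun i hi ↦ hf i (Finset.mem_insert_of_mem hi)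
    have hs' : ∀ i ∈ s, f' i ∈ formSpace (CongruenceSubgroup.Gamma N) k :=
      fun i hi ↦ hf' i (Finset.mem_insert_of_mem hi)
    exact conj_add σ (hf a (Finset.mem_insert_self a s)) (Submodule.sum_mem _ hs)
      (hf' a (Finset.mem_insert_self a s)) (Submodule.sum_mem _ hs')
      (h a (Finset.mem_insert_self a s)) (ih hs hs' fun i hi ↦ h i (Finset.mem_insert_of_mem hi))

/-- Finite products. [cite: ShimuraIATAF1971, §6.2 (Prop. 6.9: the action of `Aut(ℂ)` on Fourier coefficients)] -/
theorem conj_finset_prod {ι : Type*} (t : Finset ι) {w : ι → ℤ} {f f' : ι → ℍ → ℂ}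
    (hf : ∀ i ∈ t, f i ∈ formSpace (CongruenceSubgroup.Gamma N) (w i))
    (hf' : ∀ i ∈ t, f' i ∈ formSpace (CongruenceSubgroup.Gamma N) (w i))
    (h : ∀ i ∈ t, qExpansion (N : ℝ) (f' i) = (qExpansion (N : ℝ) (f i)).map σ) :
    qExpansion (N : ℝ) (∏ i ∈ t, f' i) = (qExpansion (N : ℝ) (∏ i ∈ t, f i)).map σ := by
  classical
  induction t using Finset.induction_on with
  | empty => rw [Finset.prod_empty, Finset.prod_empty]; exact conj_one σ
  | insert a t ha ih =>
    rw [Finset.prod_insert ha, Finset.prod_insert ha]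
    have ht : ∀ i ∈ t, f i ∈ formSpace (CongruenceSubgroup.Gamma N) (w i) :=
      fun i hi ↦ hf i (Finset.mem_insert_of_mem hi)
    have ht' : ∀ i ∈ t, f' i ∈ formSpace (CongruenceSubgroup.Gamma N) (w i) :=
      fun i hi ↦ hf' i (Finset.mem_insert_of_mem hi)
    exact conj_mul σ (hf a (Finset.mem_insert_self a t)) (prod_mem_formSpace t ht)
      (hf' a (Finset.mem_insert_self a t)) (prod_mem_formSpace t ht')
      (h a (Finset.mem_insert_self a t)) (ih ht ht' fun i hi ↦ h i (Finset.mem_insert_of_mem hi))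

/-- **The Vandermonde determinant of conjugates is the conjugate of the Vandermonde determinant**
(`δ = ∏_{i<j}(s_j - s_i)`). [cite: ShimuraIATAF1971, §6.2 (Prop. 6.9: the action of `Aut(ℂ)` on Fourier coefficients)] -/
theorem conj_vdmDet {r : ℕ} {w₀ : ℤ} {s s' : Fin r → ℍ → ℂ}
    (hs : ∀ i, s i ∈ formSpace (CongruenceSubgroup.Gamma N) w₀)
    (hs' : ∀ i, s' i ∈ formSpace (CongruenceSubgroup.Gamma N) w₀)
    (h : ∀ i, qExpansion (N : ℝ) (s' i) = (qExpansion (N : ℝ) (s i)).map σ) :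
    qExpansion (N : ℝ) (vdmDet s') = (qExpansion (N : ℝ) (vdmDet s)).map σ := by
  rw [vdmDet_eq_prod, vdmDet_eq_prod]
  refine conj_finset_prod σ (w := fun i ↦ ∑ j ∈ Finset.Ioi i, w₀) _
    (fun i _ ↦ prod_mem_formSpace _ fun j _ ↦ Submodule.sub_mem _ (hs j) (hs i))
    (fun i _ ↦ prod_mem_formSpace _ fun j _ ↦ Submodule.sub_mem _ (hs' j) (hs' i))
    (fun i _ ↦ conj_finset_prod σ (w := fun _ ↦ w₀) _ (fun j _ ↦ Submodule.sub_mem _ (hs j) (hs i))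
      (fun j _ ↦ Submodule.sub_mem _ (hs' j) (hs' i))
      fun j _ ↦ conj_sub σ (hs j) (hs i) (hs' j) (hs' i) (h j) (h i))

/-- **A form has at most one conjugate** (the `q`-expansion principle at `∞`). [cite: ShimuraIATAF1971, §6.2 (Prop. 6.9: the action of `Aut(ℂ)` on Fourier coefficients)] -/
theorem eq_of_conj_of_conj {k : ℤ} {f f₁ f₂ : ℍ → ℂ}
    (hf₁ : f₁ ∈ formSpace (CongruenceSubgroup.Gamma N) k) (hf₂ : f₂ ∈ formSpace (CongruenceSubgroup.Gamma N) k)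
    (h₁ : qExpansion (N : ℝ) f₁ = (qExpansion (N : ℝ) f).map σ)
    (h₂ : qExpansion (N : ℝ) f₂ = (qExpansion (N : ℝ) f).map σ) : f₁ = f₂ :=
  eq_of_qExpansion_eq_of_mem hf₁ hf₂ (h₁.trans h₂.symm)

/-- **Conjugation is injective**: forms with equal conjugate expansions are equal. [cite: ShimuraIATAF1971, §6.2 (Prop. 6.9: the action of `Aut(ℂ)` on Fourier coefficients)] -/
theorem eq_of_conj_eq_conj {k : ℤ} {f₁ f₂ : ℍ → ℂ}
    (hf₁ : f₁ ∈ formSpace (CongruenceSubgroup.Gamma N) k) (hf₂ : f₂ ∈ formSpace (CongruenceSubgroup.Gamma N) k)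
    (h : (qExpansion (N : ℝ) f₁).map σ = (qExpansion (N : ℝ) f₂).map σ) : f₁ = f₂ :=
  eq_of_qExpansion_eq_of_mem hf₁ hf₂ (PowerSeries.map_injective σ σ.injective h)

/-- The conjugate of a non-zero form is non-zero. [cite: ShimuraIATAF1971, §6.2 (Prop. 6.9: the action of `Aut(ℂ)` on Fourier coefficients)] -/
theorem ne_zero_of_conj {k : ℤ} {f f' : ℍ → ℂ} (hf : f ∈ formSpace (CongruenceSubgroup.Gamma N) k)
    (h : qExpansion (N : ℝ) f' = (qExpansion (N : ℝ) f).map σ) (hf0 : f ≠ 0) : f' ≠ 0 := by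
  intro h0
  rw [h0, qExpansion_zero] at h
  have h1 : (qExpansion (N : ℝ) f).map σ = (qExpansion (N : ℝ) (0 : ℍ → ℂ)).map σ := by
    rw [← h, qExpansion_zero, map_zero]
  exact hf0 (eq_of_conj_eq_conj σ hf (Submodule.zero_mem _) h1)

/-- **Division of power series is compatible with conjugation**: if `P Q = R`, `P' Q' = R'` in
`ℂ⟦X⟧` with `P ≠ 0` and `P' = σ(P)`, `R' = σ(R)`, then `Q' = σ(Q)`. [folklore] -/
private theorem PowerSeries.map_eq_of_mul_eq {P Q R P' Q' R' : PowerSeries ℂ} (hP : P ≠ 0) (h : P * Q = R)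
    (h' : P' * Q' = R') (hPP : P' = P.map σ) (hRR : R' = R.map σ) : Q' = Q.map σ := by
  have hP' : P' ≠ 0 := by
    rw [hPP]
    intro h0
    exact hP (PowerSeries.map_injective σ σ.injective (by rw [h0, map_zero]))
  have h1 : P' * Q' = P' * Q.map σ := by rw [h', hRR, ← h, map_mul, hPP]
  exact mul_left_cancel₀ hP' h1

/-- **Division in `formSpace Γ(N)` is compatible with conjugation**: if `d q = r` and `d' q' = r'`
with `d ≢ 0` and `d'`, `r'` the conjugates of `d`, `r`, then `q'` is the conjugate of `q`.
[cite: ShimuraIATAF1971, §6.2 (Prop. 6.9: the action of `Aut(ℂ)` on Fourier coefficients)] -/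
theorem conj_of_mul_left {k₁ k₂ : ℤ} {d q r d' q' r' : ℍ → ℂ}
    (hd : d ∈ formSpace (CongruenceSubgroup.Gamma N) k₁) (hq : q ∈ formSpace (CongruenceSubgroup.Gamma N) k₂)
    (hd' : d' ∈ formSpace (CongruenceSubgroup.Gamma N) k₁) (hq' : q' ∈ formSpace (CongruenceSubgroup.Gamma N) k₂)
    (hd0 : d ≠ 0) (h : d * q = r) (h' : d' * q' = r')
    (hdd : qExpansion (N : ℝ) d' = (qExpansion (N : ℝ) d).map σ)
    (hrr : qExpansion (N : ℝ) r' = (qExpansion (N : ℝ) r).map σ) :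
    qExpansion (N : ℝ) q' = (qExpansion (N : ℝ) q).map σ := by
  have hmul : qExpansion (N : ℝ) d * qExpansion (N : ℝ) q = qExpansion (N : ℝ) r := by
    rw [← qExpansion_mul (analyticAt_cuspFunction_of_mem hd) (analyticAt_cuspFunction_of_mem hq), h]
  have hmul' : qExpansion (N : ℝ) d' * qExpansion (N : ℝ) q' = qExpansion (N : ℝ) r' := by
    rw [← qExpansion_mul (analyticAt_cuspFunction_of_mem hd') (analyticAt_cuspFunction_of_mem hq'), h']
  have hd0' : qExpansion (N : ℝ) d ≠ 0 := by
    obtain ⟨D, rfl⟩ := hd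
    intro h0
    exact hd0 (congrArg DFunLike.coe
      ((ModularForm.qExpansion_eq_zero_iff (Nat.cast_pos.mpr (NeZero.pos N)) (natCast_mem_strictPeriods_Gamma N) D).mp h0))
  exact PowerSeries.map_eq_of_mul_eq σ hd0' hmul hmul' hdd hrr

end Algebra

/-! ### Level one: every form has a conjugate -/

section LevelOne

variable (σ : ℂ →+* ℂ) (N : ℕ) [NeZero N]

variable {N} in
/-- A level-one modular form with integral `q`-expansion (period `1`) has a `σ`-fixed
`q_N`-expansion. [cite: ShimuraIATAF1971, §6.2 (Prop. 6.9: the action of `Aut(ℂ)` on Fourier coefficients)] -/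
theorem map_qExpansion_eq_of_levelOne_int {w : ℤ} (F : ModularForm 𝒮ℒ w) (P₀ : PowerSeries ℤ)
    (hP : P₀.map (Int.castRingHom ℂ) = qExpansion 1 ⇑F) :
    (qExpansion (N : ℝ) ⇑F).map σ = qExpansion (N : ℝ) ⇑F := by
  ext n
  rw [PowerSeries.coeff_map, coeff_qExpansion_nat_eq F Subgroup.strictPeriods_SL2Z N n]
  split_ifs
  · rw [← hP, PowerSeries.coeff_map, eq_intCast, map_intCast]
  · exact map_zero σ

/-- **`M_w(SL₂(ℤ))` is spanned over `ℂ` by forms with `σ`-fixed `q_N`-expansions** (the monomials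
`E₄^a E₆^b`, which have integral `q`-expansions; induction on the weight via the tree's
`levelOneSpace_le_sup`).  (Shimura (6.1.3).) [cite: ShimuraIATAF1971, §6.1 (6.1.3)] -/
theorem levelOneSpace_le_span_conjFixed (w : ℤ) :
    levelOneSpace w ≤ Submodule.span ℂ
      {m | m ∈ levelOneSpace w ∧ (qExpansion (N : ℝ) m).map σ = qExpansion (N : ℝ) m} := by
  suffices h : ∀ (n : ℕ) (w : ℤ), w.toNat = n → levelOneSpace w ≤ Submodule.span ℂ
      {m | m ∈ levelOneSpace w ∧ (qExpansion (N : ℝ) m).map σ = qExpansion (N : ℝ) m} from h _ w rfl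
  intro n
  induction n using Nat.strong_induction_on with
  | _ n ih =>
  intro w hw
  rcases lt_or_ge w 0 with hneg | hnonneg
  · rw [show levelOneSpace w = ⊥ from formSpace_eq_bot_of_neg hneg]
    exact bot_le
  rcases eq_or_ne w 0 with rfl | hw0
  · rintro f ⟨F, rfl⟩
    obtain ⟨c, hc⟩ := ModularFormClass.levelOne_weight_zero_const F
    have h1 : (⇑F : ℍ → ℂ) = c • (1 : ℍ → ℂ) := by
      rw [hc]; funext z; simp
    rw [h1]
    refine Submodule.smul_mem _ c (Submodule.subset_span ⟨⟨1, ModularForm.one_coe_eq_one⟩, ?_⟩)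
    rw [qExpansion_one, map_one]
  intro f hf
  have hdec := levelOneSpace_le_sup hw0 hf
  rw [Submodule.mem_sup] at hdec
  obtain ⟨_, ⟨f₁, hf₁, rfl⟩, _, ⟨f₂, hf₂, rfl⟩, hsum⟩ := hdec
  rw [← hsum]
  simp only [LinearMap.mulLeft_apply]
  have h4 : (w - 4).toNat < n := by omega
  have h6 : (w - 6).toNat < n := by omega
  have hs₁ := ih _ h4 (w - 4) rfl hf₁
  have hs₂ := ih _ h6 (w - 6) rfl hf₂
  have hmul : ∀ (E : ℍ → ℂ) (v : ℤ), E ∈ levelOneSpace v →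
      (qExpansion (N : ℝ) E).map σ = qExpansion (N : ℝ) E → ∀ g : ℍ → ℂ,
      g ∈ Submodule.span ℂ {m | m ∈ levelOneSpace (w - v) ∧ (qExpansion (N : ℝ) m).map σ = qExpansion (N : ℝ) m} →
      E * g ∈ Submodule.span ℂ {m | m ∈ levelOneSpace w ∧ (qExpansion (N : ℝ) m).map σ = qExpansion (N : ℝ) m} := by
    intro E v hE hEσ g hg
    refine Submodule.span_induction (p := fun g _ ↦ E * g ∈ Submodule.span ℂ
      {m | m ∈ levelOneSpace w ∧ (qExpansion (N : ℝ) m).map σ = qExpansion (N : ℝ) m}) ?_ ?_ ?_ ?_ hg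
    · rintro m ⟨hm, hmσ⟩
      refine Submodule.subset_span ⟨?_, ?_⟩
      · have := mul_mem_formSpace hE hm
        rwa [show v + (w - v) = w by ring] at this
      · have hEΓ := mem_formSpace_Gamma_of_levelOne N hE
        have hmΓ := mem_formSpace_Gamma_of_levelOne N hm
        rw [qExpansion_mul (analyticAt_cuspFunction_of_mem hEΓ) (analyticAt_cuspFunction_of_mem hmΓ),
          map_mul, hEσ, hmσ]
    · rw [mul_zero]; exact Submodule.zero_mem _
    · intro x y _ _ hx hy
      rw [mul_add]; exact Submodule.add_mem _ hx hy
    · intro a x _ hx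
      rw [mul_smul_comm]; exact Submodule.smul_mem _ a hx
  obtain ⟨P₄, -, hP₄⟩ := exists_int_map_eq_qExpansion_E₄
  obtain ⟨P₆, -, hP₆⟩ := exists_int_map_eq_qExpansion_E₆
  exact Submodule.add_mem _
    (hmul _ 4 E4_mem (map_qExpansion_eq_of_levelOne_int σ E₄ P₄ hP₄) f₁ hs₁)
    (hmul _ 6 E6_mem (map_qExpansion_eq_of_levelOne_int σ E₆ P₆ hP₆) f₂ hs₂)

/-- **Every level-one form has a level-one `σ`-conjugate of the same weight**: writing
`M = ∑_t c_t m_t` with `σ`-fixed `m_t` (`levelOneSpace_le_span_conjFixed`), `M^{(σ)} = ∑_t σ(c_t) m_t`.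
[cite: ShimuraIATAF1971, §6.1 (6.1.3)] -/
theorem exists_levelOne_conj {w : ℤ} {M : ℍ → ℂ} (hM : M ∈ levelOneSpace w) :
    ∃ M' : ℍ → ℂ, M' ∈ levelOneSpace w ∧ qExpansion (N : ℝ) M' = (qExpansion (N : ℝ) M).map σ := by
  classical
  have hmem := levelOneSpace_le_span_conjFixed σ N w hM
  rw [Submodule.mem_span_set'] at hmem
  obtain ⟨n, c, m, hsum⟩ := hmem
  refine ⟨∑ t, σ (c t) • (m t : ℍ → ℂ), Submodule.sum_mem _ fun t _ ↦ Submodule.smul_mem _ _ (m t).2.1, ?_⟩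
  have hmΓ : ∀ t, (m t : ℍ → ℂ) ∈ formSpace (CongruenceSubgroup.Gamma N) w :=
    fun t ↦ mem_formSpace_Gamma_of_levelOne N (m t).2.1
  ext n'
  rw [← hsum, PowerSeries.coeff_map, qExpansion_coeff_sum_smul _ (fun t _ ↦ hmΓ t),
    qExpansion_coeff_sum_smul _ (fun t _ ↦ hmΓ t), map_sum]
  refine Finset.sum_congr rfl fun t _ ↦ ?_
  rw [map_mul]
  congr 1
  have := congrArg (PowerSeries.coeff n') (m t).2.2
  rw [PowerSeries.coeff_map] at this
  exact this.symm

end LevelOne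

/-! ### The Eisenstein input -/

section Eis

variable (σ : ℂ →+* ℂ) {N : ℕ} [NeZero N] {d d' : ℤ}

/-- **The conjugate of `c_k G_k^u` is `c_k G_k^{u·diag(1,d)}`** (`k ≥ 3`) for `σ(ζ_N) = ζ_N^d`
(`EisensteinLatticeCosetGalois.map_latticeEisensteinNorm_mul_qExpansion_coeff`), as an identity of
`q_N`-expansions of the functions `c_k • G_k^u : ℍ → ℂ`.
[cite: DiamondShurman2005, Thm. 4.2.3 and §7.7] -/
theorem conj_latticeEisenstein_smul (hσ : σ (cexp (2 * π * Complex.I / N)) = cexp (2 * π * Complex.I * d / N))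
    {k : ℕ} (hk : 3 ≤ k) (u : Fin 2 → ZMod N) :
    qExpansion (N : ℝ) (latticeEisensteinNorm N k • latticeEisenstein N k ![u 0, (d : ZMod N) * u 1]) =
      (qExpansion (N : ℝ) (latticeEisensteinNorm N k • latticeEisenstein N k u)).map σ := by
  have hmem : ∀ v : Fin 2 → ZMod N, latticeEisenstein N k v ∈ formSpace (CongruenceSubgroup.Gamma N) k :=
    fun v ↦ ⟨latticeEisensteinMF N (k := (k : ℤ)) (by exact_mod_cast hk) v, rfl⟩
  ext n
  rw [qExpansion_smul (analyticAt_cuspFunction_of_mem (hmem _)), qExpansion_smul (analyticAt_cuspFunction_of_mem (hmem _)),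
    PowerSeries.coeff_map, map_smul, map_smul, smul_eq_mul, smul_eq_mul]
  exact (map_latticeEisensteinNorm_mul_qExpansion_coeff σ hσ hk u n).symm

omit [NeZero N] in
/-- `u · diag(1,d) = (u₀, d u₁)`. [cite: ShimuraIATAF1971, §6.2 (the elements `ι(1,d)` of `GL₂(ℤ/Nℤ)`)] -/
theorem vecMul_diagonal_one (u : Fin 2 → ZMod N) :
    u ᵥ* Matrix.diagonal ![1, (d : ZMod N)] = ![u 0, (d : ZMod N) * u 1] := by
  ext j; fin_cases j <;> simp [Matrix.vecMul_diagonal, mul_comm]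

/-- **The conjugate of `E^u = c₄G_4^u` is `E^{u·diag(1,d)}`** for `σ(ζ_N) = ζ_N^d`.
[cite: DiamondShurman2005, Thm. 4.2.3 and §7.7] -/
theorem conj_eisE (hσ : σ (cexp (2 * π * Complex.I / N)) = cexp (2 * π * Complex.I * d / N))
    (u : Fin 2 → ZMod N) :
    qExpansion (N : ℝ) (eisE N (u ᵥ* Matrix.diagonal ![1, (d : ZMod N)])) =
      (qExpansion (N : ℝ) (eisE N u)).map σ := by
  unfold eisE
  rw [vecMul_diagonal_one]
  exact conj_latticeEisenstein_smul σ hσ (by norm_num) u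

omit [NeZero N] in
/-- The conjugating matrices `D = diag(1,d)`, `D' = diag(1,d')` are mutually inverse mod `N` when
`dd' ≡ 1`. [cite: ShimuraIATAF1971, §6.2 (Prop. 6.9: the action of `Aut(ℂ)` on Fourier coefficients)] -/
theorem diagonal_mul_diagonal_eq_one (hdd : ((d * d' : ℤ) : ZMod N) = 1) :
    Matrix.diagonal ![1, (d : ZMod N)] * Matrix.diagonal ![1, (d' : ZMod N)] = 1 ∧
    Matrix.diagonal ![1, (d' : ZMod N)] * Matrix.diagonal ![1, (d : ZMod N)] = 1 := by
  push_cast at hdd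
  constructor <;>
  · rw [Matrix.diagonal_mul_diagonal, ← Matrix.diagonal_one]
    congr 1
    ext i; fin_cases i <;> simp [hdd, mul_comm]

omit [NeZero N] in
/-- `det (D' g D) = 1` for `g ∈ SL₂(ℤ/Nℤ)`. [cite: ShimuraIATAF1971, §6.2 (Prop. 6.9: the action of `Aut(ℂ)` on Fourier coefficients)] -/
theorem det_diagonal_conj (hdd : ((d * d' : ℤ) : ZMod N) = 1) (g : SL(2, ZMod N)) :
    (Matrix.diagonal ![1, (d' : ZMod N)] * (g : Matrix (Fin 2) (Fin 2) (ZMod N)) * Matrix.diagonal ![1, (d : ZMod N)]).det = 1 := by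
  push_cast at hdd
  rw [Matrix.det_mul, Matrix.det_mul, g.2, Matrix.det_diagonal, Matrix.det_diagonal]
  simp [Fin.prod_univ_two, hdd, mul_comm]

/-- Reindexing: `θ_{λ'}^{D'gD} = ∑_u λ_u E^{ugD}` (`λ'_v = λ_{vD'}`, `DD' = D'D = 1`). [cite: ShimuraIATAF1971, §6.2 (Prop. 6.9: the action of `Aut(ℂ)` on Fourier coefficients)] -/
theorem thetaComb_diagConj_eq {K : Subfield ℂ} (hdd : ((d * d' : ℤ) : ZMod N) = 1)
    (coef : (Fin 2 → ZMod N) → K) (g : SL(2, ZMod N)) :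
    thetaComb K (fun v ↦ coef (v ᵥ* Matrix.diagonal ![1, (d' : ZMod N)]))
        ⟨Matrix.diagonal ![1, (d' : ZMod N)] * (g : Matrix (Fin 2) (Fin 2) (ZMod N)) * Matrix.diagonal ![1, (d : ZMod N)],
          det_diagonal_conj hdd g⟩ =
      ∑ u : Fin 2 → ZMod N, ((coef u : K) : ℂ) •
        eisE N ((u ᵥ* (g : Matrix (Fin 2) (Fin 2) (ZMod N))) ᵥ* Matrix.diagonal ![1, (d : ZMod N)]) := by
  classical
  obtain ⟨hDD', hD'D⟩ := diagonal_mul_diagonal_eq_one (N := N) hdd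
  let e : (Fin 2 → ZMod N) ≃ (Fin 2 → ZMod N) :=
    { toFun := fun u ↦ u ᵥ* Matrix.diagonal ![1, (d : ZMod N)]
      invFun := fun v ↦ v ᵥ* Matrix.diagonal ![1, (d' : ZMod N)]
      left_inv := fun u ↦ by simp only; rw [Matrix.vecMul_vecMul, hDD', Matrix.vecMul_one]
      right_inv := fun v ↦ by simp only; rw [Matrix.vecMul_vecMul, hD'D, Matrix.vecMul_one] }
  unfold thetaComb
  refine (Fintype.sum_equiv e _ _ fun u ↦ ?_).symm
  simp only [e, Equiv.coe_fn_mk]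
  rw [Matrix.vecMul_vecMul, Matrix.vecMul_vecMul, Matrix.vecMul_vecMul, hDD', Matrix.vecMul_one,
    show Matrix.diagonal ![1, (d : ZMod N)] *
        (Matrix.diagonal ![1, (d' : ZMod N)] * (g : Matrix (Fin 2) (Fin 2) (ZMod N)) * Matrix.diagonal ![1, (d : ZMod N)]) =
      (Matrix.diagonal ![1, (d : ZMod N)] * Matrix.diagonal ![1, (d' : ZMod N)]) * (g : Matrix (Fin 2) (Fin 2) (ZMod N)) *
        Matrix.diagonal ![1, (d : ZMod N)] by simp only [Matrix.mul_assoc],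
    hDD', Matrix.one_mul]

/-- **The conjugate of `θ_λ^g = ∑_u λ_u E^{ug}`** (`σ`-fixed coefficients `λ_u`) is
`θ_{λ'}^{D' g D}` with `λ'_v = λ_{vD'}` (`D = diag(1,d)`, `D' = diag(1,d')`, `dd' ≡ 1 (N)`).
[cite: ShimuraIATAF1971, §6.2] -/
theorem conj_thetaComb {K : Subfield ℂ} (hK : ∀ x ∈ K, σ x = x)
    (hσ : σ (cexp (2 * π * Complex.I / N)) = cexp (2 * π * Complex.I * d / N))
    (hdd : ((d * d' : ℤ) : ZMod N) = 1) (coef : (Fin 2 → ZMod N) → K) (g : SL(2, ZMod N)) :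
    qExpansion (N : ℝ) (thetaComb K (fun v ↦ coef (v ᵥ* Matrix.diagonal ![1, (d' : ZMod N)]))
        ⟨Matrix.diagonal ![1, (d' : ZMod N)] * (g : Matrix (Fin 2) (Fin 2) (ZMod N)) * Matrix.diagonal ![1, (d : ZMod N)],
          det_diagonal_conj hdd g⟩) =
      (qExpansion (N : ℝ) (thetaComb K coef g)).map σ := by
  classical
  rw [thetaComb_diagConj_eq hdd]
  unfold thetaComb
  refine conj_sum σ (k := 4) _ (fun u _ ↦ Submodule.smul_mem _ _ (eisE_mem _))
    (fun u _ ↦ Submodule.smul_mem _ _ (eisE_mem _)) fun u _ ↦ ?_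
  have h := conj_smul σ (eisE_mem _) (eisE_mem _) (conj_eisE σ hσ (u ᵥ* (g : Matrix (Fin 2) (Fin 2) (ZMod N))))
    ((coef u : K) : ℂ)
  rwa [hK _ (coef u).2] at h

end Eis

end Literature.NumberTheory.ModularForms

end
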